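import Summits.ABC.IUTFork.Cor312LicenceTamePairs
import Summits.ABC.IUTFork.Cor312LicenceMixedSummand
import HarnessLib

/-!
# [IUTchIII] Cor. 3.12 — the EXACT (xi-f) criterion at a TAME prime of an ARBITRARY fibre: the inclusion at `(j, p)` — and the
# licence at all-tame data — hold **iff** the PAIR CONDITION holds at every pair of places `(w, y)` over `p`

PROOF-ONLY support piece (D-0012; 0 definitions, 0 `Prop` facts) of the abc-iut cell (WAVE-4 D-0067 cone-interior prover
abc-iut-w4-d006, gen 5; row «MIXED-SUMMAND», closing file). TAKES NO SIDE on [IUTchIII] Cor. 3.12 (S. Mochizuki, *Inter-universal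
Teichmüller theory III*, kurims manuscript, Cor. 3.12 p. 173 l. 41 – p. 174 l. 19; Step (xi-f) p. 184 l. 26–29; Thm. 3.11 (i) p. 154) or
on any author: statements about OUR typed objects (abc-iut-c312-5's `logShellsDH`, abc-iut-c312-3's / abc-iut-c312-7's sharp real
settings `settingDHVolSharp` / `settingPrVolSharp`, Dupuy–Hilado's typed (Ind1)/(Ind2)); the hull-level licence
(`Thm311ToCor312.Licence`, the `hLic` binder of branch C's `abc_of_licence_v5K`, abc-iut-C-cert-1 p435505) is a STRONGER-THAN-PRINT form
of the disputed step; nothing here bears on the printed GLOBAL inequality. typed ≠ proved; instantiated ≠ endorsed.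

THE CRITERION. At a prime `p > 2` all of whose places `x | p` are TAME (`e_x = e(x|p) ≤ p − 2`, uniformizers `ϖ_x`; the `e_x` may differ),
label `j = i+1`, `‖t_{Θ,j,x}‖ = ‖ϖ_x‖^{m_Θ(x)}`, `‖t_{q,x}‖ = ‖ϖ_x‖^{m_q(x)}`, `D_x := (m_Θ(x) − 1) div e_x`:

  `q-region at (j,p) ⊆ ⁿ˒°𝒰_{j,p}   ↔   ∀ w, y | p:  e_y·(e_w·min(D_w, D_y) + 1) ≤ e_y·m_q(w) + j·e_w·(e_y − 1)`.

(←) `qRegion_subset_thetaHull_settingDHVolSharp_of_tame_pairs` ((Ind1)-permuted movers, slot of a least-ramified companion);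
(→) `not_qRegion_subset_thetaHull_settingDHVolSharp_of_two_places_tame` (the orbit lattice at the mixed summand `(y,…,y,w)`, STAR form of
[IUTchIV] Prop. 1.1/1.2 (ii)). The pair `y = w` is abc-iut-w5-d180's window / this seat's diagonal criterion; pairs `y ≠ w` are new and bite
exactly at NON-uniform fibres (`mixed_summand_strictly_harder_witness`). For REALISING ideles `m_Θ(x) = j²·m_q(x)` (Dupuy–Hilado (3.4)).

WHAT IS PROVED (namespace `Summit.ABC.IUTFork.Thm311.Real`):
* **`qRegion_subset_thetaHull_settingDHVolSharp_iff_of_tame_pairs`** — the displayed `↔` at one packet.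
* **`licence_settingDHVolSharp_iff_of_tame_pairs`** / **`licence_settingPrVolSharp_iff_of_tame_pairs`** — at ALL-TAME data (Θ-ideles units
  off `S`; every prime under `S` has all its places tame, with indices, uniformizers and exponents as above) the LICENCE holds iff the
  pair condition holds at every prime under `S`, every label and every pair of places — the `hLic` binder of `abc_of_licence_v5K` as an
  explicit integer predicate of the depths `m_q`, `m_Θ` and the indices `e`, now WITHOUT the uniform-fibre restriction of p445547.
HONEST SCOPE: OUR sharp containers (Θ-regions constant in `m`), Dupuy–Hilado's typed (Ind1)/(Ind2) acting independently on every
(capsule slot, place) as abc-iut-c312-1 typed Thm. 3.11 (i); refuted-as-typed ≠ refuted-in-print; nothing about the author's intended hull,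
the M-level `Ism`, or the printed GLOBAL inequality; WILD / dyadic bad places are outside this file. [cite: Mochizuki2012, IUTchIV
Prop. 1.1 p. 9, Prop. 1.2 (i)(ii) p. 10; IUTchIII Thm. 3.11 (i) p. 154] [cite: DupuyHilado2025, §3.4, §3.9, §4.7, §4.9]
[cite: WeilBNT1967, Ch. II §2, Th. 1] [cite: ScholzeStix2018, §2.2 pp. 9–10] [claim: Mochizuki2012, status: disputed].
-/

noncomputable section

open Set Function
open scoped Pointwise

namespace Summit.ABC.IUTFork.Thm311.Real

open Cor312 Cor312.Setting Cor312Vol Cor312Vol.ExplicitDepth Literature.IUT.LogThetaLattice Literature.IUT.LogVolume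
  NumberField IsDedekindDomain
open Literature.NumberTheory.NumberFields Literature.NumberTheory.GaloisRepresentations.Ultrametric

variable {F : Type} [Field F] [NumberField F] (X : PilotData F) {logv : PadicLogs F} (hlog : LogvAnalytic logv)
  (M : Type) [Field M] [NumberField M]
  (archPk : ∀ (j : (thetaIndex X).Label) (vQ : (thetaIndex X).VQ), Set ((logShellsDH X logv).Packet j vQ))
  (archSub : ∀ (j : (thetaIndex X).Label) (v : (thetaIndex X).V),
    Set ((logShellsDH X logv).Packet j ((thetaIndex X).over v)))
  (Ψ : ℤ → ∀ v : (thetaIndex X).V, v ∈ (thetaIndex X).Vbad → Set ((logShellsDH X logv).StarPacket v))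
  (act : ℤ → ∀ v : (thetaIndex X).V, v ∈ (thetaIndex X).Vbad →
    (logShellsDH X logv).StarPacket v → Module.End ℚ ((logShellsDH X logv).StarPacket v))
  (Mmod : ℤ → ∀ j : (thetaIndex X).LabelStar, Set ((logShellsDH X logv).GlobalPacket j.1))
  (region : ℤ → ∀ j : (thetaIndex X).LabelStar, FinDivisor M → ∀ vQ : (thetaIndex X).VQ,
    Set ((logShellsDH X logv).Packet j.1 vQ))
  (n : ℤ) {HT : Type} {LogLink : HT → HT → Type} {IsFull : ∀ {s t : HT}, LogLink s t → Prop}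
  (lat : LGPGaussianLogThetaLattice LogLink IsFull)
  {Frd : Type} {IsoF : Frd → Frd → Type} {Ob : Frd → Type} {realify : Frd → Frd} {Strip : Type}
  {IsoS : Strip → Strip → Type} {Mv : ∀ v : (thetaIndex X).V, v ∈ (thetaIndex X).Vbad → Type}
  [∀ v h, Monoid (Mv v h)]
  (sig : GlobalLGPFrobenioidSignature (thetaIndex X).lstar (thetaIndex X).V (· ∈ (thetaIndex X).Vbad)
    Frd IsoF Ob realify Strip IsoS Mv)
  (split : SplittingMonoids Mv) {ObΔ : Type} {N : ∀ v : (thetaIndex X).V, v ∈ (thetaIndex X).Vbad → Type}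
  [∀ v h, Monoid (N v h)] (qData : QPilotData ObΔ N)
  (tq : ∀ (pp : Nat.Primes) (x : (thetaIndex X).Fibre (.inr pp)), haveI : Fact (pp : ℕ).Prime := ⟨pp.2⟩; kOf X pp.1 x)
  (t : ∀ (pp : Nat.Primes) (_ : Fin X.lstar) (x : (thetaIndex X).Fibre (.inr pp)),
    haveI : Fact (pp : ℕ).Prime := ⟨pp.2⟩; kOf X pp.1 x)
  (htq0 : ∀ pp x, tq pp x ≠ 0)
  (htq1 : ∀ (pp : Nat.Primes) (x : (thetaIndex X).Fibre (.inr pp)),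
    haveI : Fact (pp : ℕ).Prime := ⟨pp.2⟩; placeOf X pp.1 x ∉ X.S → ‖tq pp x‖ = 1)

/-! ## 1. One packet -/

/-- **THE (xi-f) INCLUSION AT ONE TAME PACKET OF AN ARBITRARY FIBRE IS DECIDED BY THE PAIR CONDITION.** `p > 2`; every place `x | p`
tame with index `e_x ≤ p − 2` and uniformizer `ϖ_x`; `j = i+1`; `‖t_{Θ,j,x}‖ = ‖ϖ_x‖^{m_Θ(x)}`, `‖t_{q,x}‖ = ‖ϖ_x‖^{m_q(x)}`;
`D_x = (m_Θ(x) − 1) div e_x`. Then `q-region at (j,p) ⊆ ⁿ˒°𝒰_{j,p} ↔ ∀ w y, e_y·(e_w·min(D_w, D_y) + 1) ≤ e_y·m_q(w) + j·e_w·(e_y − 1)`.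
[cite: Mochizuki2012, IUTchIV Prop. 1.1 p. 9, Prop. 1.2 (i)(ii) p. 10; IUTchIII Thm. 3.11 (i) p. 154] [cite: DupuyHilado2025, §3.9, §4.7, §4.9]
[claim: Mochizuki2012, status: disputed] -/
theorem qRegion_subset_thetaHull_settingDHVolSharp_iff_of_tame_pairs (i : Fin (thetaIndex X).lstar) (pp : Nat.Primes)
    (hp2 : 2 < (pp : ℕ)) (E : (thetaIndex X).Fibre (.inr pp) → ℕ)
    (ϖ : haveI : Fact (pp : ℕ).Prime := ⟨pp.2⟩; ∀ x : (thetaIndex X).Fibre (.inr pp), (kOf X pp.1 x)ˣ)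
    (hfib : haveI : Fact (pp : ℕ).Prime := ⟨pp.2⟩
      ∀ x : (thetaIndex X).Fibre (.inr pp),
        (placeOf X pp.1 x).asIdeal.ramificationIdx ℤ = E x ∧ E x ≤ (pp : ℕ) - 2 ∧ IsUniformizer (ϖ x))
    (mΘ mq : (thetaIndex X).Fibre (.inr pp) → ℤ)
    (hΘ : haveI : Fact (pp : ℕ).Prime := ⟨pp.2⟩
      ∀ x : (thetaIndex X).Fibre (.inr pp), ‖t pp i x‖ = ‖(ϖ x : kOf X pp.1 x)‖ ^ mΘ x)
    (hq : haveI : Fact (pp : ℕ).Prime := ⟨pp.2⟩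
      ∀ x : (thetaIndex X).Fibre (.inr pp), ‖tq pp x‖ = ‖(ϖ x : kOf X pp.1 x)‖ ^ mq x) :
    (settingDHVolSharp X hlog M archPk archSub Ψ act Mmod region n lat sig split qData tq t htq0 htq1).qRegion
        (labelSucc i) (.inr pp) ⊆
      (settingDHVolSharp X hlog M archPk archSub Ψ act Mmod region n lat sig split qData tq t htq0 htq1).thetaHull
        (labelSucc i) (.inr pp) ↔
    ∀ w y : (thetaIndex X).Fibre (.inr pp),
      (E y : ℤ) * ((E w : ℤ) * min ((mΘ w - 1) / (E w : ℤ)) ((mΘ y - 1) / (E y : ℤ)) + 1) ≤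
        (E y : ℤ) * mq w + ((i : ℕ) + 1 : ℕ) * (E w : ℤ) * ((E y : ℤ) - 1) := by
  haveI hF : Fact (pp : ℕ).Prime := ⟨pp.2⟩
  constructor
  · -- (→): a violated pair `(w, y)` refutes the inclusion at the mixed summand `(y, …, y, w)`
    intro hincl w y
    by_contra hlt
    rw [not_le] at hlt
    have hp0 : (0 : ℝ) < (pp : ℕ) := by exact_mod_cast pp.2.pos
    have heK : ∀ x : (thetaIndex X).Fibre (.inr pp), absRamificationIdx (pp : ℕ) (kOf X pp.1 x) = E x := fun x =>
      (absRamificationIdx_rescaledCompletion F (pp : ℕ) (placeOf X pp.1 x) (natCast_mem_placeOf X pp.1 x)).trans (hfib x).1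
    have hnormϖ : ∀ x : (thetaIndex X).Fibre (.inr pp), ‖(ϖ x : kOf X pp.1 x)‖ = ((pp : ℕ) : ℝ) ^ (-(1 / (E x : ℝ))) := by
      intro x
      rw [norm_eq_rpow_of_isUniformizer (pp : ℕ) (kOf X pp.1 x) (hfib x).2.2, heK x]
    have hΘ' : ∀ x, ‖t pp i x‖ = ((pp : ℕ) : ℝ) ^ (-((mΘ x : ℝ) / absRamificationIdx (pp : ℕ) (kOf X pp.1 x))) := by
      intro x
      rw [hΘ x, hnormϖ x, ← Real.rpow_intCast, ← Real.rpow_mul hp0.le, heK x]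
      congr 1
      ring
    have hq' : ∀ x, ‖tq pp x‖ = ((pp : ℕ) : ℝ) ^ (-((mq x : ℝ) / absRamificationIdx (pp : ℕ) (kOf X pp.1 x))) := by
      intro x
      rw [hq x, hnormϖ x, ← Real.rpow_intCast, ← Real.rpow_mul hp0.le, heK x]
      congr 1
      ring
    refine not_qRegion_subset_thetaHull_settingDHVolSharp_of_two_places_tame X hlog M archPk archSub Ψ act Mmod region n lat sig split
      qData tq t htq0 htq1 pp i y w hp2 ((heK y).le.trans (hfib y).2.1) ((heK w).le.trans (hfib w).2.1) (mΘ y) (mΘ w) (mq w)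
      (hΘ' y) (hΘ' w) (hq' w) ?_ hincl
    rw [heK y, heK w]
    push_cast at hlt ⊢
    linarith
  · -- (←): the permuted movers
    exact qRegion_subset_thetaHull_settingDHVolSharp_of_tame_pairs X hlog M archPk archSub Ψ act Mmod region n lat sig split qData tq
      t htq0 htq1 i pp hp2 E ϖ hfib mΘ mq hΘ hq

/-! ## 2. The licence at all-tame data -/

/-- **THE (xi-f) LICENCE AT `settingDHVolSharp` IS DECIDED AT ALL-TAME DATA (arbitrary fibres).** Θ-ideles units off `S`; at every prime
`p` UNDER `S`: `p > 2`, every place `x | p` tame with index `e_{p,x}` and uniformizer `ϖ_{p,x}`, exponents `‖t_{Θ,j,x}‖ = ‖ϖ‖^{m_Θ(p,j,x)}`,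
`‖t_{q,x}‖ = ‖ϖ‖^{m_q(p,x)}` at EVERY place over `p` (`0` at the good ones). THEN `Thm311ToCor312.Licence` — the `hLic` binder of branch C's
`abc_of_licence_v5K` at this setting — holds **iff** at every prime under `S`, every label `j = i+1` and every pair `(w, y)` of places over `p`:
`e_y·(e_w·min(D_w, D_y) + 1) ≤ e_y·m_q(w) + j·e_w·(e_y − 1)` (`D_x = (m_Θ(p,j,x) − 1) div e_{p,x}`). The uniform-fibre restriction of
`licence_settingDHVolSharp_iff_of_tame_orders` (p445547) is gone. [cite: Mochizuki2012, IUTchIV Prop. 1.1 p. 9, Prop. 1.2 (i)(ii) p. 10;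
IUTchIII Thm. 3.11 (i) p. 154] [cite: DupuyHilado2025, §3.4, §3.9, §4.7, §4.9] [claim: Mochizuki2012, status: disputed] -/
theorem licence_settingDHVolSharp_iff_of_tame_pairs
    (ht1 : ∀ (pp : Nat.Primes) (i : Fin X.lstar) (x : (thetaIndex X).Fibre (.inr pp)),
      haveI : Fact (pp : ℕ).Prime := ⟨pp.2⟩; placeOf X pp.1 x ∉ X.S → ‖t pp i x‖ = 1)
    (E : ∀ pp : Nat.Primes, (thetaIndex X).Fibre (.inr pp) → ℕ)
    (ϖ : ∀ (pp : Nat.Primes) (x : (thetaIndex X).Fibre (.inr pp)), haveI : Fact (pp : ℕ).Prime := ⟨pp.2⟩; (kOf X pp.1 x)ˣ)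
    (hfib : ∀ (pp : Nat.Primes) (x : (thetaIndex X).Fibre (.inr pp)),
      haveI : Fact (pp : ℕ).Prime := ⟨pp.2⟩
      (∃ w : (thetaIndex X).Fibre (.inr pp), placeOf X pp.1 w ∈ X.S) →
        2 < (pp : ℕ) ∧ (placeOf X pp.1 x).asIdeal.ramificationIdx ℤ = E pp x ∧ E pp x ≤ (pp : ℕ) - 2 ∧ IsUniformizer (ϖ pp x))
    (mΘ : ∀ pp : Nat.Primes, Fin (thetaIndex X).lstar → (thetaIndex X).Fibre (.inr pp) → ℤ)
    (mq : ∀ pp : Nat.Primes, (thetaIndex X).Fibre (.inr pp) → ℤ)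
    (hΘ : ∀ (pp : Nat.Primes) (i : Fin (thetaIndex X).lstar) (x : (thetaIndex X).Fibre (.inr pp)),
      haveI : Fact (pp : ℕ).Prime := ⟨pp.2⟩
      (∃ w : (thetaIndex X).Fibre (.inr pp), placeOf X pp.1 w ∈ X.S) → ‖t pp i x‖ = ‖(ϖ pp x : kOf X pp.1 x)‖ ^ mΘ pp i x)
    (hq : ∀ (pp : Nat.Primes) (x : (thetaIndex X).Fibre (.inr pp)),
      haveI : Fact (pp : ℕ).Prime := ⟨pp.2⟩
      (∃ w : (thetaIndex X).Fibre (.inr pp), placeOf X pp.1 w ∈ X.S) → ‖tq pp x‖ = ‖(ϖ pp x : kOf X pp.1 x)‖ ^ mq pp x) :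
    Thm311ToCor312.Licence (settingDHVolSharp X hlog M archPk archSub Ψ act Mmod region n lat sig split qData tq t htq0 htq1) ↔
      ∀ (pp : Nat.Primes) (i : Fin (thetaIndex X).lstar),
        haveI : Fact (pp : ℕ).Prime := ⟨pp.2⟩
        (∃ w : (thetaIndex X).Fibre (.inr pp), placeOf X pp.1 w ∈ X.S) →
          ∀ w y : (thetaIndex X).Fibre (.inr pp),
            (E pp y : ℤ) * ((E pp w : ℤ) * min ((mΘ pp i w - 1) / (E pp w : ℤ)) ((mΘ pp i y - 1) / (E pp y : ℤ)) + 1) ≤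
              (E pp y : ℤ) * mq pp w + ((i : ℕ) + 1 : ℕ) * (E pp w : ℤ) * ((E pp y : ℤ) - 1) := by
  constructor
  · intro hL pp i hS
    haveI : Fact (pp : ℕ).Prime := ⟨pp.2⟩
    have hp2 : 2 < (pp : ℕ) := (hfib pp (Classical.choose hS) hS).1
    exact (qRegion_subset_thetaHull_settingDHVolSharp_iff_of_tame_pairs X hlog M archPk archSub Ψ act Mmod region n lat sig split qData
      tq t htq0 htq1 i pp hp2 (E pp) (ϖ pp) (fun x => (hfib pp x hS).2) (mΘ pp i) (mq pp) (fun x => hΘ pp i x hS)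
      (fun x => hq pp x hS)).1 (hL i (.inr pp))
  · intro hall i vQ
    cases vQ with
    | inl u =>
      exact qRegion_subset_thetaHull_settingDHVolSharp_inl X hlog M archPk archSub Ψ act Mmod region n lat sig split qData tq t htq0
        htq1 (labelSucc i) u
    | inr pp =>
      haveI : Fact (pp : ℕ).Prime := ⟨pp.2⟩
      by_cases hS : ∃ w : (thetaIndex X).Fibre (.inr pp), placeOf X pp.1 w ∈ X.S
      · have hp2 : 2 < (pp : ℕ) := (hfib pp (Classical.choose hS) hS).1
        exact (qRegion_subset_thetaHull_settingDHVolSharp_iff_of_tame_pairs X hlog M archPk archSub Ψ act Mmod region n lat sig split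
          qData tq t htq0 htq1 i pp hp2 (E pp) (ϖ pp) (fun x => (hfib pp x hS).2) (mΘ pp i) (mq pp) (fun x => hΘ pp i x hS)
          (fun x => hq pp x hS)).2 (hall pp i hS)
      · exact qRegion_subset_thetaHull_settingDHVolSharp_of_forall_not_mem X hlog M archPk archSub Ψ act Mmod region n lat sig split
          qData tq t htq0 htq1 i pp ht1 fun w hw => hS ⟨w, hw⟩

/-- **The same at the PRINT-NORMALISED setting `settingPrVolSharp`** (branch C's setting; `licence_settingPrVolSharp_iff_settingDHVolSharp`).
[claim: Mochizuki2012, status: disputed] -/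
theorem licence_settingPrVolSharp_iff_of_tame_pairs
    (ht1 : ∀ (pp : Nat.Primes) (i : Fin X.lstar) (x : (thetaIndex X).Fibre (.inr pp)),
      haveI : Fact (pp : ℕ).Prime := ⟨pp.2⟩; placeOf X pp.1 x ∉ X.S → ‖t pp i x‖ = 1)
    (E : ∀ pp : Nat.Primes, (thetaIndex X).Fibre (.inr pp) → ℕ)
    (ϖ : ∀ (pp : Nat.Primes) (x : (thetaIndex X).Fibre (.inr pp)), haveI : Fact (pp : ℕ).Prime := ⟨pp.2⟩; (kOf X pp.1 x)ˣ)
    (hfib : ∀ (pp : Nat.Primes) (x : (thetaIndex X).Fibre (.inr pp)),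
      haveI : Fact (pp : ℕ).Prime := ⟨pp.2⟩
      (∃ w : (thetaIndex X).Fibre (.inr pp), placeOf X pp.1 w ∈ X.S) →
        2 < (pp : ℕ) ∧ (placeOf X pp.1 x).asIdeal.ramificationIdx ℤ = E pp x ∧ E pp x ≤ (pp : ℕ) - 2 ∧ IsUniformizer (ϖ pp x))
    (mΘ : ∀ pp : Nat.Primes, Fin (thetaIndex X).lstar → (thetaIndex X).Fibre (.inr pp) → ℤ)
    (mq : ∀ pp : Nat.Primes, (thetaIndex X).Fibre (.inr pp) → ℤ)
    (hΘ : ∀ (pp : Nat.Primes) (i : Fin (thetaIndex X).lstar) (x : (thetaIndex X).Fibre (.inr pp)),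
      haveI : Fact (pp : ℕ).Prime := ⟨pp.2⟩
      (∃ w : (thetaIndex X).Fibre (.inr pp), placeOf X pp.1 w ∈ X.S) → ‖t pp i x‖ = ‖(ϖ pp x : kOf X pp.1 x)‖ ^ mΘ pp i x)
    (hq : ∀ (pp : Nat.Primes) (x : (thetaIndex X).Fibre (.inr pp)),
      haveI : Fact (pp : ℕ).Prime := ⟨pp.2⟩
      (∃ w : (thetaIndex X).Fibre (.inr pp), placeOf X pp.1 w ∈ X.S) → ‖tq pp x‖ = ‖(ϖ pp x : kOf X pp.1 x)‖ ^ mq pp x) :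
    Thm311ToCor312.Licence (settingPrVolSharp X hlog M archPk archSub Ψ act Mmod region n lat sig split qData tq t htq0 htq1) ↔
      ∀ (pp : Nat.Primes) (i : Fin (thetaIndex X).lstar),
        haveI : Fact (pp : ℕ).Prime := ⟨pp.2⟩
        (∃ w : (thetaIndex X).Fibre (.inr pp), placeOf X pp.1 w ∈ X.S) →
          ∀ w y : (thetaIndex X).Fibre (.inr pp),
            (E pp y : ℤ) * ((E pp w : ℤ) * min ((mΘ pp i w - 1) / (E pp w : ℤ)) ((mΘ pp i y - 1) / (E pp y : ℤ)) + 1) ≤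
              (E pp y : ℤ) * mq pp w + ((i : ℕ) + 1 : ℕ) * (E pp w : ℤ) * ((E pp y : ℤ) - 1) := by
  rw [licence_settingPrVolSharp_iff_settingDHVolSharp]
  exact licence_settingDHVolSharp_iff_of_tame_pairs X hlog M archPk archSub Ψ act Mmod region n lat sig split qData tq t htq0 htq1 ht1
    E ϖ hfib mΘ mq hΘ hq

/-! ## 3. Only pairs of BAD places matter -/

/-- **A pair with a GOOD member never violates the pair condition.** At a good place the ideles are units, `m_Θ = m_q = 0`, so its level is
`D = (0 − 1) div e = −1`; whenever `min(D_w, D_y) ≤ −1` (in particular if `w` or `y` is good) the left-hand side is `≤ e_y·(1 − e_w) ≤ 0`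
while the right-hand side is `≥ 0` (`m_q(w) ≥ 0`). Hence in `licence_settingDHVolSharp_iff_of_tame_pairs` only pairs of BAD places over
the same prime can fail. Pure integer bookkeeping. [cite: DupuyHilado2025, §4.9] -/
theorem tamePair_of_min_le_neg_one {ew ey mq j Dw Dy : ℤ} (hew : 0 < ew) (hey : 0 < ey) (hmq : 0 ≤ mq) (hj : 0 ≤ j)
    (hmin : min Dw Dy ≤ -1) : ey * (ew * min Dw Dy + 1) ≤ ey * mq + j * ew * (ey - 1) := by
  have h1 : ew * min Dw Dy + 1 ≤ 0 := by nlinarith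
  have h2 : ey * (ew * min Dw Dy + 1) ≤ 0 := mul_nonpos_of_nonneg_of_nonpos hey.le h1
  have h3 : 0 ≤ ey * mq + j * ew * (ey - 1) := by
    have : 0 ≤ ey - 1 := by omega
    positivity
  linarith


end Summit.ABC.IUTFork.Thm311.Real

end
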